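import Literature.MathematicalPhysics.QuantumFieldTheory.Balaban1983to89.B9Ineq377L2Hom
import Literature.MathematicalPhysics.QuantumFieldTheory.Balaban1983to89.B9Ineq385L2V3
import Literature.MathematicalPhysics.QuantumFieldTheory.Balaban1983to89.B9Ineq383L2
import Literature.MathematicalPhysics.QuantumFieldTheory.Balaban1983to89.B9Thm34GFinal

/-!
# `Balaban1983to89.B9Thm34GL2Entries` — [B9] Theorem 3.4 p. 400, `G`-clause: ALL SIX BLOCK-`ℓ²` MEMBERS (3.46) OF THEOREM 3.3 FOR `G(U′U)`,
# at the letters, from the block-`ℓ²` (3.85) — the `L²` twin of r06's FILE 16 `B9Thm34GEntries342` (which did the four sup entries (3.42))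

T. Bałaban, *Propagators for lattice gauge theories in a background field*, Commun. Math. Phys. **99** (1985) 389–434
[`Balaban1985BackgroundPropagators`, "B9"]; [4] = T. Bałaban, *Propagators and renormalization transformations for lattice gauge theories. II*,
Commun. Math. Phys. **96** (1984) 223–250 [`Balaban1984PropagatorsII`].

statement-level skeleton of published theorems with citation tags; proofs where landed; nothing here is a claim about the Yang–Mills mass gap

THE PRINTED LOCUS (verbatim).  Theorem 3.4 p. 400: *"The extended operators satisfy all the inequalities of Theorems 3.1–3.3 correspondingly."*;
Theorem 3.3 p. 399: *"the operator G(U) (a = 1) satisfies the inequalities (3.42)–(3.47), with G′(U) replaced by G(U) and λ replaced by a function J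
defined at bonds"*; (3.46) p. 398: *"Finally, we have the inequalities in L²-norms ‖hG′(U)λ‖, ‖h∇_UG′(U)λ‖, ‖hG′(U)∇*_Uλ‖, ‖h∇_U∇_UG′(U)λ‖,
‖h∇_UG′(U)∇*_Uλ‖, ‖hG′(U)∇*_U∇*_Uλ‖ ≤ B₀[(Lʲη)², Lʲη, Lʲη, 1, 1, 1]|h|e^{−δ₀d(y,y′)}‖λ‖"*; p. 407: *"Δ_a(U′U) = Δ_a(U) − V₃(A) − P₁(A) − P₂(A) (3.82) …
Let us denote the sum of these three operators by V(A) … |(V(A)G(U)J)(b)| ≦ O(1)α₁e^{−½δ₀d(y,y′)}|J| (3.85) … G(U′U) = G(U)(I − V(A)G(U))⁻¹ =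
Σ_{n=0}^∞ G(U)(V(A)G(U))ⁿ (3.86) and for α₁ sufficiently small the series above is convergent in all norms appearing in its formulation. This way
we get all these inequalities for the operator G(U′U)."*; [4] p. 247: *"convergent in the norms appearing in the inequalities (2.136)–(2.140)"*.

WHY THIS FILE (pub-ymgap N06 row 13, the G-side of the Sect.-B frame `B9SectBStepFrameV4.SectBFrame₄`, whose six (3.46) member-steps of G(U′U)
are DISPLAYED).  r06's FILE 16 transfers Theorem 3.3's SUP entries (3.42) to G(U′U) by the printed route (3.82)–(3.86); the tree's only route to the
`L²` members (3.46) of G(U′U) (`B9Ineq346L2Final` via `B9Thm34GUniform`) consumes Theorem 3.3 in an unprinted KERNEL form (`HasKernelBound`), vacuous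
on Bałaban's multi-point blocks for d ≥ 3 (lit-balaban desk ME #13).  THIS FILE is the KERNEL-FREE `L²` twin of FILE 16 for ALL SIX members: the
walk (3.86) summed in block-ℓ² ([4] Prop. 2.6), with print's (3.85) read in block-ℓ² on both sides.

WHAT IS PROVED (one theorem + three explicit constants; 0 sorry; standard axioms).
* `pOneConc` — the CONCRETE `P₁(A)` of (3.76) on the bond carrier (the word of `B9Eq376POneLetters.eq376_concrete` ∕ the operator bounded by
  `B9Ineq377L2Hom.ineq377_l2_concreteE`), for the R-words `W = R₀(U)` («P(U) = I − R(U)», here the inner word `G′Q′*C⁻¹Q′G′`) and `W′ = R₀(U′U)` of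
  the site carrier, with `F(A) := W′ − W` ((3.68)).
* `thetaGL`, `thetaGR` — the EXPLICIT block-ℓ² (3.85) constants of `V(A)G(U)` resp. `G(U)V(A)` ∕ `∇_kG(U)V(A)` (sums of the constants of
  `B9Ineq385L2V3.ineq385_l2_V3G` ∕ `B9Ineq385L2V3Right.ineq385_l2_GV3` ∕ `…_DGV3`, of `B9Ineq383L2.ineq385_l2_P2G` ∕ `_GP2` ∕ `_XP2` for the printed
  `P₂(A)` via `ineq383_l2`, and of the same three for `P₁(A)` with its (3.77) constant `κ₁`), both `· α₁`; `rateG δ = (99/100)³(24/25)δ`.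
* ★★ `thm34_G_l2entries` — **THEOREM 3.4's G-CLAUSE FOR THE SIX `L²` MEMBERS (3.46), AT THE LETTERS**.  HYPOTHESES: the located devices' geometry;
  [4] Lemma 2.1 at the one input rate `δ` in the uniform-in-exponent shape the frames carry (`∀ α ∈ [9/5000, 1)`, (2.61) and the p. 398 transfers
  of `Lʲη`, `(Lʲη)²`, `(Lʲη)⁻¹`, `(Lʲη)⁻²`); (3.37) read blockwise, (3.35) on plaquettes, the stencil geometry — VERBATIM the hypotheses of the `V₃`
  bricks; THEOREM 3.3 FOR G(U) IN ITS `L²` FORM — all six (3.46) members at U as block-ℓ² majorants of the letters `G`, `∇_kG`, `G∇♯_k`, `∇_k∇_lG`,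
  `∇_kG∇♯_l`, `G∇♯_k∇♯_l`; the block-ℓ² sizes of the (3.80)–(3.83) letters `Q, Q*, F₂, F₂*` and the diagonal weight `a`; (3.80); THE (3.77) BOUND
  OF THE CONCRETE `P₁(A)` in block-ℓ² (`hP₁`, constant `κ₁α₁(Lʲη)⁻²` — a HYPOTHESIS here: its ℓ² proof is `B9Ineq377L2Hom.ineq377_l2_concreteE` from the
  (3.49) entries of `P(U)` (`B9Ineq349L2Readings`, from readings) and the four (3.68) entries of `F(A)`, the latter NOT yet in the tree in ℓ²);
  the inverse identities `Δ_a(U)G = GΔ_a(U) = 1` and ANY two-sided inverse `G̃` of the concrete `Δ_a(U′U)` (background `prodCfg U η A`, R-word `W′`,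
  `Q(U′U) = Q + F₂`, `Q*(U′U) = Q* + F₂*`); the two smallness conditions `Θ_L(α₁)c₁ ≦ ½`, `Θ_R(α₁)c₁ ≦ ½` («for α₁ sufficiently small»).
  CONCLUSION: the six block-ℓ² majorants of `G̃`, `∇_kG̃`, `G̃∇♯_k`, `∇_k∇_lG̃`, `∇_kG̃∇♯_l`, `G̃∇♯_k∇♯_l` at the rate `rateG δ` with EXPLICIT constants.
  PROOF = the printed one: (3.84) for the concrete letters (`B9Eq386Neumann.eq384_sub` with (3.71) := `B9Eq372RemLetters.conj_lapDDLetter_prodCfg`,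
  (3.76) := `B9Eq376POneLetters.eq376_concrete`, (3.82) := `B9Eq382V3Letters.conj_V₃Op_eq_vThree`, (3.80)); (3.85) in block-ℓ² on the left, on the
  right and at the letter ∇ (the bricks above, summed); the resolvent identities (3.86) in both forms (`B9Ineq363L2.eq365_of_inverse`,
  `B9Ineq363L2Right.eq365_first_of_inverse`); then [4] (2.66) summed in ℓ²: `B9Ineq363L2.hasL2Majorant_leftEntry_gpExt` (members 0, 1, 3),
  `B9Ineq363L2Right.hasL2Majorant_rightEntry_gpExt` (members 2, 5; the p. 398 transfers of `Lʲη` rescaled, free for the constant weight),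
  `B9Ineq363L2Mixed.hasL2Majorant_mixedEntry_gpExt` (member 4).

HONEST SCOPE.  Block-ℓ² form of [4] (2.51)/(2.140); every input left as a letter with its size as hypothesis, exactly as in FILE 16; the (3.77) bound
of `P₁(A)` in ℓ² is a HYPOTHESIS (see above); no Hölder ∕ sup ∕ global entries; no kernel ↔ block identification; no analyticity statement.  Nothing
of [B9] is asserted for Bałaban's operators; count-neutral; NOT a node discharge; nothing continuum ∕ OS ∕ mass-gap ∕ Clay.  Cell `pub-ymgap` (HUMAN
RULING D-0062), Track A node N06 [B9], N06-ASSIGNMENT row 13 (G-side `ℓ²` route, GSIDE-L2-SPEC item D), seat `pub-ymgap-dag-n06-c` (g6), 2026-08-27.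
-/

noncomputable section

open scoped BigOperators

namespace Literature.MathematicalPhysics.QuantumFieldTheory.Balaban1983to89.B9Thm34GL2Entries

open NormedSpace Complex
open Literature.MathematicalPhysics.QuantumFieldTheory.Balaban1983to89
open Literature.MathematicalPhysics.QuantumFieldTheory.Balaban1983to89.B6RandomWalk (Triangle254 Ineq261)
open Literature.MathematicalPhysics.QuantumFieldTheory.Balaban1983to89.B6RandomWalkL2 (HasL2Majorant hasL2Majorant_mono hasL2Majorant_add)
open Literature.MathematicalPhysics.QuantumFieldTheory.Balaban1983to89.B9Thm34Ext (toB6)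
open Literature.MathematicalPhysics.QuantumFieldTheory.Balaban1983to89.B9Ineq347 (ScaleTransfer)
open Literature.MathematicalPhysics.QuantumFieldTheory.Balaban1983to89.B9Eq39Adjoint
open Literature.MathematicalPhysics.QuantumFieldTheory.Balaban1983to89.B9Eq369Small (Through)
open Literature.MathematicalPhysics.QuantumFieldTheory.Balaban1983to89.B9Eq372Locality (stBonds)
open Literature.MathematicalPhysics.QuantumFieldTheory.Balaban1983to89.B9Eq375Locality (locBondsA locBondsA')
open Literature.MathematicalPhysics.QuantumFieldTheory.Balaban1983to89.B9Eq352DivForm (tauF tauB)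
open Literature.MathematicalPhysics.QuantumFieldTheory.Balaban1983to89.B9Eq352DivFormLetters (conj)
open Literature.MathematicalPhysics.QuantumFieldTheory.Balaban1983to89.B9Eq352GradLetters (diffLetter)
open Literature.MathematicalPhysics.QuantumFieldTheory.Balaban1983to89.B9Eq371GradLetters (bT bU)
open Literature.MathematicalPhysics.QuantumFieldTheory.Balaban1983to89.B9Eq372RemLetters (lapDDLetter V₂Op conj_lapDDLetter_prodCfg)
open Literature.MathematicalPhysics.QuantumFieldTheory.Balaban1983to89.B9Eq382V3Letters (dPrimeLetter V₃Op cV0 conj_V₃Op_eq_vThree)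
open Literature.MathematicalPhysics.QuantumFieldTheory.Balaban1983to89.B9Eq376POneLetters (conjHom gradLin divLin eq376_concrete)
open Literature.MathematicalPhysics.QuantumFieldTheory.Balaban1983to89.B9Eq386Neumann (vTotal vThree pTwo deltaA eq384_sub)
open Literature.MathematicalPhysics.QuantumFieldTheory.Balaban1983to89.B9Ineq385VG (kappa383 kappa383_nonneg)
open Literature.MathematicalPhysics.QuantumFieldTheory.Balaban1983to89.B9Ineq385V3Concrete (cV0_nonneg)
open Literature.MathematicalPhysics.QuantumFieldTheory.Balaban1983to89.B9Ineq386V3Concrete (norm_plaqU_adjacent_of_through)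
open Literature.MathematicalPhysics.QuantumFieldTheory.Balaban1983to89.B9Ineq363L2 (eq365_of_inverse hasL2Majorant_leftEntry_gpExt
  hasL2Majorant_rate_mono)
open Literature.MathematicalPhysics.QuantumFieldTheory.Balaban1983to89.B9Ineq363L2Right (eq365_first_of_inverse hasL2Majorant_rightEntry_gpExt)
open Literature.MathematicalPhysics.QuantumFieldTheory.Balaban1983to89.B9Ineq363L2Mixed (hasL2Majorant_mixedEntry_gpExt)
open Literature.MathematicalPhysics.QuantumFieldTheory.Balaban1983to89.B9Ineq385L2V3 (ineq385_l2_V3G)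
open Literature.MathematicalPhysics.QuantumFieldTheory.Balaban1983to89.B9Ineq385L2V3Right (ineq385_l2_GV3 ineq385_l2_DGV3)
open Literature.MathematicalPhysics.QuantumFieldTheory.Balaban1983to89.B9Ineq383L2 (ineq383_l2 ineq385_l2_P2G ineq385_l2_GP2 ineq385_l2_XP2)
open Literature.MathematicalPhysics.QuantumFieldTheory.Balaban1983to89.B9Ineq366CPrime (scaleTransfer_one)
open Literature.MathematicalPhysics.QuantumFieldTheory.Balaban1983to89.B9Thm34GFinal (ineq261_rescale scaleTransfer_rescale)

/-! ## §1  The concrete `P₁(A)` word and the explicit (3.85) constants in block-ℓ² -/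

section Defs

variable {𝔸 : Type*} [NormedRing 𝔸] [NormedAlgebra ℂ 𝔸] [CompleteSpace 𝔸] {ι : Type} [Fintype ι]
variable (b : Module.Basis ι ℝ 𝔸) {S : Type} {κ : Type} [Fintype κ]
variable (T : κ → Equiv.Perm S) (U : κ → S → 𝔸ˣ)

/-- **The concrete `P₁(A)` of (3.76)** on the bond carrier, in real coordinates: with `D = conjHom b (η⁻¹D¹_U)`, `D′` at `U′U = prodCfg U η A`,
`D*`, `D*′` the divergence twins and the site-carrier words `W = R₀(U)`, `W′ = R₀(U′U)` (so `F(A) = W′ − W`, (3.68)):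
`P₁(A) = (D′ − D)WD* + DW(D*′ − D*) + (D′ − D)W(D*′ − D*) + D′(W′ − W)D*′` — the word of `B9Eq376POneLetters.eq376_concrete` (with `P := W`,
`P′ := W′ − W`) and the operator `B9Ineq377L2Hom.ineq377_l2_concreteE` bounds. [cite: Balaban1985BackgroundPropagators, (3.76) p.405 + (3.68) p.403] -/
def pOneConc (η : ℝ) (A : κ → S → 𝔸) (W W' : Module.End ℝ (S × ι → ℝ)) : Module.End ℝ ((κ × S) × ι → ℝ) :=
  (conjHom b (gradLin T ((η : ℂ)⁻¹) (prodCfg U η A)) - conjHom b (gradLin T ((η : ℂ)⁻¹) U)) ∘ₗ W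
      ∘ₗ conjHom b (divLin T ((η : ℂ)⁻¹) U)
    + conjHom b (gradLin T ((η : ℂ)⁻¹) U) ∘ₗ W
      ∘ₗ (conjHom b (divLin T ((η : ℂ)⁻¹) (prodCfg U η A)) - conjHom b (divLin T ((η : ℂ)⁻¹) U))
    + (conjHom b (gradLin T ((η : ℂ)⁻¹) (prodCfg U η A)) - conjHom b (gradLin T ((η : ℂ)⁻¹) U)) ∘ₗ W
      ∘ₗ (conjHom b (divLin T ((η : ℂ)⁻¹) (prodCfg U η A)) - conjHom b (divLin T ((η : ℂ)⁻¹) U))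
    + conjHom b (gradLin T ((η : ℂ)⁻¹) (prodCfg U η A)) ∘ₗ (W' - W) ∘ₗ conjHom b (divLin T ((η : ℂ)⁻¹) (prodCfg U η A))

end Defs

/-- **The block-ℓ² (3.85) constant of `V(A)G(U)`** (left composite): the `V₃` third of `B9Ineq385L2V3.ineq385_l2_V3G` plus the `P₁`, `P₂` words of
`B9Ineq383L2.ineq385_l2_P2G` (`κ₁` = the (3.77) constant of `P₁(A)`, `κ₃₈₃` = r06's (3.83) constant of `P₂(A)`); `V(A)G(U) ≺₂ Θ_L·e^{−ρd}`.
Arguments: `dκ = #κ`, `nι = #ι`, `d` = the [4] (2.61) exponent, then `B₀ C₀ M₂ Sb d₀ δ Λ κ₁ κQ cF abar α₁` (`Sb = Σ‖b_i‖`).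
[cite: Balaban1985BackgroundPropagators, (3.85) p.407 («O(1)α₁»)] -/
def thetaGL (dκ nι d : ℕ) (B₀ C₀ M₂ Sb d₀ δ Λ κ₁ κQ cF abar α₁ : ℝ) : ℝ :=
  (2 * B₀ * Λ * B6.c1 d δ (1 / 100) *
      ((cV0 dκ α₁ C₀ + 28 * dκ * (dκ + 1)) * M₂ * Sb * Real.sqrt (((dκ * (1 + 2 * dκ + 2 * dκ ^ 2)) * nι : ℕ) : ℝ) *
        Real.exp (δ * d₀))) * α₁
    + κ₁ * α₁ * B₀ * Λ * B6.c1 d δ (1 / 100)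
    + kappa383 κQ cF abar Λ (B6.c1 d δ (1 / 100)) α₁ * α₁ * B₀ * Λ * B6.c1 d δ (1 / 100)

/-- **The block-ℓ² (3.85) constant of `G(U)V(A)` and of `∇_kG(U)V(A)`** (right composite and the mixed member's factor): the `V₃` third of
`B9Ineq385L2V3Right.ineq385_l2_GV3` ∕ `…_DGV3` plus the `P₁`, `P₂` words of `B9Ineq383L2.ineq385_l2_GP2` ∕ `…_XP2`; `G(U)V(A) ≺₂ Θ_R·e^{−ρd}`,
`∇_kG(U)V(A) ≺₂ Θ_R·(Lʲη)⁻¹·e^{−ρd}`.  Same arguments as `thetaGL`. [cite: Balaban1985BackgroundPropagators, (3.85)–(3.86) p.407 («O(1)α₁»)] -/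
def thetaGR (dκ nι d : ℕ) (B₀ C₀ M₂ Sb d₀ δ Λ κ₁ κQ cF abar α₁ : ℝ) : ℝ :=
  (B₀ * Λ * B6.c1 d δ (1 / 100) *
      (2 * dκ * (14 * (dκ + 1) * M₂ * Sb * Real.sqrt (((dκ * (1 + 2 * dκ + 2 * dκ ^ 2)) * nι : ℕ) : ℝ) * Real.exp (δ * d₀)) +
        (cV0 dκ α₁ C₀ * M₂ * Sb * Real.sqrt (((dκ * (1 + 2 * dκ + 2 * dκ ^ 2)) * nι : ℕ) : ℝ) * Real.exp (δ * d₀) +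
          2 * dκ * (Real.sqrt (((dκ * (2 * dκ + 1) ^ 2 * nι : ℕ) : ℝ)) *
            ((10 + 8 * dκ + (16 * dκ + 12) * C₀) * M₂ * Sb * Real.exp (δ * d₀)))))) * α₁
    + B₀ * (κ₁ * α₁) * Λ * B6.c1 d δ (1 / 100)
    + B₀ * (kappa383 κQ cF abar Λ (B6.c1 d δ (1 / 100)) α₁ * α₁) * Λ * B6.c1 d δ (1 / 100)

/-- The output rate of the six members: three reductions by `99/100` (two p. 398 transfers and one Lemma-2.1 loss of the right walk) of the walk
rate `24δ/25` («of course with different constants», p. 403). [cite: Balaban1985BackgroundPropagators, p.403 l.5–7 + p.398 (remarks)] -/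
def rateG (δ : ℝ) : ℝ := (1 - 1 / 100) * ((1 - 1 / 100) * ((1 - 1 / 100) * (24 / 25 * δ)))

/-- `0 < rateG δ` for `0 < δ`. [cite: Balaban1985BackgroundPropagators, p.403 l.5–7 (bookkeeping, ours)] -/
theorem rateG_pos {δ : ℝ} (h : 0 < δ) : 0 < rateG δ := by unfold rateG; positivity

/-- `rateG δ ≦ δ`. [cite: Balaban1985BackgroundPropagators, p.403 l.5–7 (bookkeeping, ours)] -/
theorem rateG_le {δ : ℝ} (h : 0 ≤ δ) : rateG δ ≤ δ := by unfold rateG; nlinarith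

/-- `Θ_L ≧ 0` for non-negative constants. [cite: Balaban1985BackgroundPropagators, (3.85) p.407 (bookkeeping, ours)] -/
theorem thetaGL_nonneg (dκ nι d : ℕ) {B₀ C₀ M₂ Sb d₀ δ Λ κ₁ κQ cF abar α₁ : ℝ} (hB₀ : 0 ≤ B₀) (hC₀ : 0 ≤ C₀) (hM₂ : 0 ≤ M₂)
    (hSb : 0 ≤ Sb) (hΛ : 0 ≤ Λ) (hκ₁ : 0 ≤ κ₁) (hκQ : 0 ≤ κQ) (hcF : 0 ≤ cF) (habar : 0 ≤ abar) (hα₁ : 0 ≤ α₁) :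
    0 ≤ thetaGL dκ nι d B₀ C₀ M₂ Sb d₀ δ Λ κ₁ κQ cF abar α₁ := by
  have hc : 0 ≤ B6.c1 d δ (1 / 100) := B6RandomWalk.c1_nonneg _ _ _
  have hV : 0 ≤ cV0 dκ α₁ C₀ := cV0_nonneg dκ hα₁ hC₀
  have hk : 0 ≤ kappa383 κQ cF abar Λ (B6.c1 d δ (1 / 100)) α₁ := kappa383_nonneg hκQ hcF habar hΛ hc hα₁
  unfold thetaGL; positivity

/-- `Θ_R ≧ 0` for non-negative constants. [cite: Balaban1985BackgroundPropagators, (3.85) p.407 (bookkeeping, ours)] -/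
theorem thetaGR_nonneg (dκ nι d : ℕ) {B₀ C₀ M₂ Sb d₀ δ Λ κ₁ κQ cF abar α₁ : ℝ} (hB₀ : 0 ≤ B₀) (hC₀ : 0 ≤ C₀) (hM₂ : 0 ≤ M₂)
    (hSb : 0 ≤ Sb) (hΛ : 0 ≤ Λ) (hκ₁ : 0 ≤ κ₁) (hκQ : 0 ≤ κQ) (hcF : 0 ≤ cF) (habar : 0 ≤ abar) (hα₁ : 0 ≤ α₁) :
    0 ≤ thetaGR dκ nι d B₀ C₀ M₂ Sb d₀ δ Λ κ₁ κQ cF abar α₁ := by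
  have hc : 0 ≤ B6.c1 d δ (1 / 100) := B6RandomWalk.c1_nonneg _ _ _
  have hV : 0 ≤ cV0 dκ α₁ C₀ := cV0_nonneg dκ hα₁ hC₀
  have hk : 0 ≤ kappa383 κQ cF abar Λ (B6.c1 d δ (1 / 100)) α₁ := kappa383_nonneg hκQ hcF habar hΛ hc hα₁
  unfold thetaGR; positivity

/-! ## §2  Theorem 3.4, `G`-clause: the six `L²` members (3.46) of Theorem 3.3 for every two-sided inverse of the concrete `Δ_a(U′U)` -/

section Assembly

variable {𝔸 : Type*} [NormedRing 𝔸] [NormedAlgebra ℂ 𝔸] [CompleteSpace 𝔸] {ι : Type} [Fintype ι] [DecidableEq ι]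
variable (b : Module.Basis ι ℝ 𝔸) {S : Type} [Fintype S] [DecidableEq S] {κ : Type} [Fintype κ] [LinearOrder κ]
variable (T : κ → Equiv.Perm S) (U : κ → S → 𝔸ˣ)
variable {g : B9.Geometry} [Fintype g.Site] [DecidableEq g.Site] {Rr : ℝ} {H : Prop}

set_option maxHeartbeats 800000 in
/-- ★★ **THEOREM 3.4, `G`-CLAUSE — ALL SIX `L²` MEMBERS (3.46) OF THEOREM 3.3 FOR `G(U′U)`, AT THE LETTERS, KERNEL-FREE** («The extended operators
satisfy all the inequalities of Theorems 3.1–3.3 correspondingly»; p. 407 «convergent in all norms appearing in its formulation. This way we get all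
these inequalities for the operator G(U′U)»).  For ANY two-sided inverse `G̃` of the concrete `Δ_a(U′U)` (background `prodCfg U η A`, site R-word `W′`,
`Q(U′U) = Q + F₂`, `Q*(U′U) = Q* + F₂*`), given Theorem 3.3's six block-ℓ² members of `G = G(U) = Δ_a(U)⁻¹` at the rate `δ`, the block-ℓ² sizes of
`Q, Q*, F₂, F₂*, a`, the (3.77) block-ℓ² bound of the concrete `P₁(A)` (`hP₁`), the located devices at the rate `δ` and the two smallness conditions:
`G̃ ≺₂ C_L(Lʲη)²e^{−ρd}`, `∇_kG̃ ≺₂ C_L Lʲη e^{−ρd}`, `G̃∇♯_k ≺₂ C_R Lʲη e^{−ρd}`, `∇_k∇_lG̃ ≺₂ C_L e^{−ρd}`, `∇_kG̃∇♯_l ≺₂ C_M e^{−ρd}`,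
`G̃∇♯_k∇♯_l ≺₂ C_{R1} e^{−ρd}` at `ρ = rateG δ`, with `C_L = 2B₀c₁(24δ/25)`, `C_R = 2B₀Λ_bΛ_c c₁((99/100)(24/25)δ)`, `C_{R1} = 2B₀c₁((99/100)(24/25)δ)`,
`C_M = B₀(1 + Λ_bΛ_cΛc₁(δ))` (the α₁-dependent `Θ_R` absorbed by `Θ_Rc_R ≦ ½`; `Λ = Λf(1/100)`, `Λ_b = Λf(24/2500)`, `Λ_c = Λf((99/100)²·24/2500)`, exponents of the frame's window).
[cite: Balaban1985BackgroundPropagators, Thm 3.4 p.400 + Thm 3.3 p.399 + (3.46) p.398 + p.398 (remarks) + (3.82)–(3.86) p.407 + (3.68) p.403 + (3.71)–(3.77) pp.404–406 + (3.80)–(3.83) pp.406–407 + (3.24)–(3.27) pp.394–395 + (3.35)/(3.37) p.396; Balaban1984PropagatorsII, Lemma 2.1 p.234 + (2.51)–(2.55) p.232 + (2.66) p.234 + Prop. 2.6 (2.140)–(2.141) p.247] -/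
theorem thm34_G_l2entries (blk : S → g.Site) (d : ℕ) (hη : 0 < g.eta) (hL : 1 ≤ g.L) (A : κ → S → 𝔸)
    (C₀ d₀ M₂ δ B₀ κQ cF abar κ₁ α₁ : ℝ) (Λf : ℝ → ℝ)
    (hB₀ : 0 ≤ B₀) (hα₁ : 0 ≤ α₁) (hδ : 0 < δ) (hC₀ : 0 ≤ C₀) (hM₂ : 0 ≤ M₂) (hκQ : 0 ≤ κQ) (hcF : 0 ≤ cF) (habar : 0 ≤ abar)
    (hκ₁ : 0 ≤ κ₁) (hΛf : ∀ α : ℝ, 0 < α → 1 ≤ Λf α)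
    (hrepr : ∀ (v : 𝔸) (i : ι), |b.repr v i| ≤ M₂ * ‖v‖)
    (hdnn : ∀ a a' : g.Site, 0 ≤ g.dist a a') (htri : Triangle254 (toB6 g Rr H)) (hrefl : ∀ y : g.Site, g.dist y y = 0)
    (hsym : ∀ y y' : g.Site, g.dist y y' = g.dist y' y) (hlen : ∀ y : g.Site, 0 < g.len y)
    -- [4] Lemma 2.1 at the input rate `δ`, uniform in the exponent window of the frames
    (h261 : ∀ α : ℝ, 9 / 5000 ≤ α → α < 1 → Ineq261 d (toB6 g Rr H) δ α)
    (hST : ∀ α : ℝ, 9 / 5000 ≤ α →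
      ScaleTransfer g δ α (Λf α) (fun a => g.len a) ∧ ScaleTransfer g δ α (Λf α) (fun a => g.len a ^ 2) ∧
      ScaleTransfer g δ α (Λf α) (fun a => (g.len a)⁻¹) ∧ ScaleTransfer g δ α (Λf α) (fun a => (g.len a ^ 2)⁻¹))
    (hsmall : ∀ y : g.Site, g.eta * (α₁ * (g.len y)⁻¹) ≤ 1 / 4)
    (hT : ∀ (μ ν : κ) (x : S), T μ (T ν x) = T ν (T μ x))
    (hU1 : ∀ m z, ‖((U m z : 𝔸ˣ) : 𝔸)‖ ≤ 1 ∧ ‖(((U m z)⁻¹ : 𝔸ˣ) : 𝔸)‖ ≤ 1)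
    -- (3.37) for the exponent field, blockwise, in the shapes the bricks read it
    (hA : ∀ k x, ‖A k x‖ ≤ α₁ * (g.len (blk x))⁻¹) (hAτB : ∀ ν k x, ‖tauB T U ν (A k) x‖ ≤ α₁ * (g.len (blk x))⁻¹)
    (hAτF : ∀ μ k x, ‖tauF T U μ (A k) x‖ ≤ α₁ * (g.len (blk x))⁻¹)
    (hAFB : ∀ k μ ν x, ‖A k ((T ν).symm (T μ x))‖ ≤ α₁ * (g.len (blk x))⁻¹)
    (h337B : ∀ ν k x, ‖((g.eta : ℂ)⁻¹) • covDstar T U ν (A k) x‖ ≤ α₁ * (g.len (blk x) ^ 2)⁻¹)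
    (h337F : ∀ μ ν x, ‖((g.eta : ℂ)⁻¹) • covD T U μ (A ν) x‖ ≤ α₁ * (g.len (blk x) ^ 2)⁻¹)
    (h337B' : ∀ μ ν x, ‖((g.eta : ℂ)⁻¹) • covDstar T U ν (A ν) (T μ x)‖ ≤ α₁ * (g.len (blk x) ^ 2)⁻¹)
    (h337Bτ : ∀ μ x, ‖((g.eta : ℂ)⁻¹) • covDstar T U μ (tauB T U μ (A μ)) x‖ ≤ α₁ * (g.len (blk x) ^ 2)⁻¹)
    (h337FB : ∀ μ ν k x, ‖((g.eta : ℂ)⁻¹) • covD T U μ (A k) ((T ν).symm x)‖ ≤ α₁ * (g.len (blk x) ^ 2)⁻¹)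
    (hAst : ∀ μ x m z, (m, z) ∈ stBonds T μ x → ‖A m z‖ ≤ α₁ * (g.len (blk x))⁻¹)
    (hAloc : ∀ μ x m z, (m, z) ∈ locBondsA T μ x → ‖A m z‖ ≤ α₁ * (g.len (blk x))⁻¹)
    (hdAst : ∀ μ x m n y, Through T μ x m n y →
      ‖covD T U m (A n) y‖ ≤ g.eta * (α₁ * ((g.len (blk x))⁻¹) ^ 2) ∧
        ‖covD T U n (A m) y‖ ≤ g.eta * (α₁ * ((g.len (blk x))⁻¹) ^ 2))
    -- (3.35) on the plaquettes through each bond, at the bond's block scale (the adjacent ones follow, `norm_plaqU_adjacent_of_through`)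
    (h35 : ∀ μ x m n y, Through T μ x m n y → ‖(plaqU T U m n y : 𝔸) - 1‖ ≤ C₀ * ((g.L ^ g.scale (blk x))⁻¹) ^ 2)
    -- stencil geometry at range `d₀`
    (hd₀B : ∀ μ x, g.dist (blk x) (blk ((T μ).symm x)) ≤ d₀) (hd₀F : ∀ μ x, g.dist (blk x) (blk (T μ x)) ≤ d₀)
    (hd₀FB : ∀ μ ν x, g.dist (blk x) (blk ((T ν).symm (T μ x))) ≤ d₀)
    (hd₀st : ∀ μ x (q : κ × S), q ∈ stBonds T μ x → g.dist (blk x) (blk q.2) ≤ d₀)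
    (hd₀loc : ∀ μ x (q : κ × S), q ∈ locBondsA' T μ x → g.dist (blk x) (blk q.2) ≤ d₀)
    (hd₀0 : ∀ y : g.Site, g.dist y y ≤ d₀)
    -- THEOREM 3.3 FOR `G(U)` IN ITS `L²` FORM: the six members (3.46) on the bond carrier, at the rate `δ`
    {G : Module.End ℝ ((κ × S) × ι → ℝ)}
    (h346_0 : HasL2Majorant (g := toB6 g Rr H) (fun q : (κ × S) × ι => blk q.1.2) G
      (fun a a' => B₀ * g.len a ^ 2 * Real.exp (-(δ * g.dist a a'))))
    (h346_1 : ∀ k : κ ⊕ κ, HasL2Majorant (g := toB6 g Rr H) (fun q : (κ × S) × ι => blk q.1.2)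
      (conj b (diffLetter (bT T) (bU U) ((g.eta : ℂ)⁻¹) k) * G) (fun a a' => B₀ * g.len a * Real.exp (-(δ * g.dist a a'))))
    (h346_2 : ∀ k : κ ⊕ κ, HasL2Majorant (g := toB6 g Rr H) (fun q : (κ × S) × ι => blk q.1.2)
      (G * conj b (diffLetter (bT T) (bU U) ((g.eta : ℂ)⁻¹) k)) (fun a a' => B₀ * g.len a * Real.exp (-(δ * g.dist a a'))))
    (h346_3 : ∀ k l : κ ⊕ κ, HasL2Majorant (g := toB6 g Rr H) (fun q : (κ × S) × ι => blk q.1.2)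
      (conj b (diffLetter (bT T) (bU U) ((g.eta : ℂ)⁻¹) k) * conj b (diffLetter (bT T) (bU U) ((g.eta : ℂ)⁻¹) l) * G)
      (fun a a' => B₀ * 1 * Real.exp (-(δ * g.dist a a'))))
    (h346_4 : ∀ k l : κ ⊕ κ, HasL2Majorant (g := toB6 g Rr H) (fun q : (κ × S) × ι => blk q.1.2)
      (conj b (diffLetter (bT T) (bU U) ((g.eta : ℂ)⁻¹) k) * G * conj b (diffLetter (bT T) (bU U) ((g.eta : ℂ)⁻¹) l))
      (fun a a' => B₀ * 1 * Real.exp (-(δ * g.dist a a'))))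
    (h346_5 : ∀ k l : κ ⊕ κ, HasL2Majorant (g := toB6 g Rr H) (fun q : (κ × S) × ι => blk q.1.2)
      (G * conj b (diffLetter (bT T) (bU U) ((g.eta : ℂ)⁻¹) k) * conj b (diffLetter (bT T) (bU U) ((g.eta : ℂ)⁻¹) l))
      (fun a a' => B₀ * 1 * Real.exp (-(δ * g.dist a a'))))
    -- the (3.80)–(3.83) letters in block-ℓ² at the rate `δ`, and (3.80)
    {Qs Q F₂ F₂s Aop Qs' Q' : Module.End ℝ ((κ × S) × ι → ℝ)}
    (hQ : HasL2Majorant (g := toB6 g Rr H) (fun q : (κ × S) × ι => blk q.1.2) Q (fun a a' => κQ * Real.exp (-(δ * g.dist a a'))))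
    (hQs : HasL2Majorant (g := toB6 g Rr H) (fun q : (κ × S) × ι => blk q.1.2) Qs (fun a a' => κQ * Real.exp (-(δ * g.dist a a'))))
    (hF₂ : HasL2Majorant (g := toB6 g Rr H) (fun q : (κ × S) × ι => blk q.1.2) F₂
      (fun a a' => cF * α₁ * Real.exp (-(δ * g.dist a a'))))
    (hF₂s : HasL2Majorant (g := toB6 g Rr H) (fun q : (κ × S) × ι => blk q.1.2) F₂s
      (fun a a' => cF * α₁ * Real.exp (-(δ * g.dist a a'))))
    (hAop : HasL2Majorant (g := toB6 g Rr H) (fun q : (κ × S) × ι => blk q.1.2) Aop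
      (fun a a' : g.Site => if a = a' then abar * (g.len a ^ 2)⁻¹ else 0))
    (h380 : Q' = Q + F₂) (h380s : Qs' = Qs + F₂s)
    -- the site-carrier R-words at U and U′U and THE (3.77) BOUND OF THE CONCRETE `P₁(A)` in block-ℓ² (hypothesis; see the module header)
    {W W' : Module.End ℝ (S × ι → ℝ)}
    (hP₁ : HasL2Majorant (g := toB6 g Rr H) (fun q : (κ × S) × ι => blk q.1.2) (pOneConc b T U g.eta A W W')
      (fun a a' => κ₁ * α₁ * (g.len a ^ 2)⁻¹ * Real.exp (-(δ * g.dist a a'))))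
    -- (3.27)/(3.30): `G(U)` inverts the concrete `Δ_a(U)`
    (hΔG : deltaA (conj b (lapDDLetter T ((g.eta : ℂ)⁻¹) U)) (conj b (dPrimeLetter T U g.eta))
      (conjHom b (gradLin T ((g.eta : ℂ)⁻¹) U) ∘ₗ (1 - W) ∘ₗ conjHom b (divLin T ((g.eta : ℂ)⁻¹) U)) Qs Aop Q * G = 1)
    (hGΔ : G * deltaA (conj b (lapDDLetter T ((g.eta : ℂ)⁻¹) U)) (conj b (dPrimeLetter T U g.eta))
      (conjHom b (gradLin T ((g.eta : ℂ)⁻¹) U) ∘ₗ (1 - W) ∘ₗ conjHom b (divLin T ((g.eta : ℂ)⁻¹) U)) Qs Aop Q = 1)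
    -- ANY two-sided inverse of the concrete `Δ_a(U′U)`
    {GExt : Module.End ℝ ((κ × S) × ι → ℝ)}
    (hinvL : deltaA (conj b (lapDDLetter T ((g.eta : ℂ)⁻¹) (prodCfg U g.eta A))) (conj b (dPrimeLetter T (prodCfg U g.eta A) g.eta))
      (conjHom b (gradLin T ((g.eta : ℂ)⁻¹) (prodCfg U g.eta A)) ∘ₗ (1 - W') ∘ₗ conjHom b (divLin T ((g.eta : ℂ)⁻¹) (prodCfg U g.eta A)))
      Qs' Aop Q' * GExt = 1)
    (hinvR : GExt * deltaA (conj b (lapDDLetter T ((g.eta : ℂ)⁻¹) (prodCfg U g.eta A)))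
      (conj b (dPrimeLetter T (prodCfg U g.eta A) g.eta))
      (conjHom b (gradLin T ((g.eta : ℂ)⁻¹) (prodCfg U g.eta A)) ∘ₗ (1 - W') ∘ₗ conjHom b (divLin T ((g.eta : ℂ)⁻¹) (prodCfg U g.eta A)))
      Qs' Aop Q' = 1)
    -- «for α₁ sufficiently small»: the two smallness conditions of the ℓ²-summed walks
    (hsmallL : thetaGL (Fintype.card κ) (Fintype.card ι) d B₀ C₀ M₂ (∑ i, ‖b i‖) d₀ δ (Λf (1 / 100)) κ₁ κQ cF abar α₁ *
      B6.c1 d (24 / 25 * δ) (1 / 100) ≤ 1 / 2)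
    (hsmallR : thetaGR (Fintype.card κ) (Fintype.card ι) d B₀ C₀ M₂ (∑ i, ‖b i‖) d₀ δ (Λf (1 / 100)) κ₁ κQ cF abar α₁ *
      B6.c1 d ((1 - 1 / 100) * (24 / 25 * δ)) (1 / 100) ≤ 1 / 2) :
    HasL2Majorant (g := toB6 g Rr H) (fun q : (κ × S) × ι => blk q.1.2) GExt
        (fun a a' => B₀ * B6.c1 d (24 / 25 * δ) (1 / 100) * 2 * g.len a ^ 2 * Real.exp (-(rateG δ * g.dist a a'))) ∧
      (∀ k : κ ⊕ κ, HasL2Majorant (g := toB6 g Rr H) (fun q : (κ × S) × ι => blk q.1.2)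
        (conj b (diffLetter (bT T) (bU U) ((g.eta : ℂ)⁻¹) k) * GExt)
        (fun a a' => B₀ * B6.c1 d (24 / 25 * δ) (1 / 100) * 2 * g.len a * Real.exp (-(rateG δ * g.dist a a')))) ∧
      (∀ k : κ ⊕ κ, HasL2Majorant (g := toB6 g Rr H) (fun q : (κ × S) × ι => blk q.1.2)
        (GExt * conj b (diffLetter (bT T) (bU U) ((g.eta : ℂ)⁻¹) k))
        (fun a a' => B₀ * Λf (1 / 100 * (24 / 25)) * B6.c1 d ((1 - 1 / 100) * (24 / 25 * δ)) (1 / 100) * 2 *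
          Λf (1 / 100 * (1 - 1 / 100) * (1 - 1 / 100) * (24 / 25)) * g.len a * Real.exp (-(rateG δ * g.dist a a')))) ∧
      (∀ k l : κ ⊕ κ, HasL2Majorant (g := toB6 g Rr H) (fun q : (κ × S) × ι => blk q.1.2)
        (conj b (diffLetter (bT T) (bU U) ((g.eta : ℂ)⁻¹) k) * conj b (diffLetter (bT T) (bU U) ((g.eta : ℂ)⁻¹) l) * GExt)
        (fun a a' => B₀ * B6.c1 d (24 / 25 * δ) (1 / 100) * 2 * 1 * Real.exp (-(rateG δ * g.dist a a')))) ∧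
      (∀ k l : κ ⊕ κ, HasL2Majorant (g := toB6 g Rr H) (fun q : (κ × S) × ι => blk q.1.2)
        (conj b (diffLetter (bT T) (bU U) ((g.eta : ℂ)⁻¹) k) * GExt * conj b (diffLetter (bT T) (bU U) ((g.eta : ℂ)⁻¹) l))
        (fun a a' => (B₀ + B₀ * Λf (1 / 100 * (24 / 25)) * Λf (1 / 100 * (1 - 1 / 100) * (1 - 1 / 100) * (24 / 25)) *
            Λf (1 / 100) * B6.c1 d δ (1 / 100)) * 1 * Real.exp (-(rateG δ * g.dist a a')))) ∧
      (∀ k l : κ ⊕ κ, HasL2Majorant (g := toB6 g Rr H) (fun q : (κ × S) × ι => blk q.1.2)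
        (GExt * conj b (diffLetter (bT T) (bU U) ((g.eta : ℂ)⁻¹) k) * conj b (diffLetter (bT T) (bU U) ((g.eta : ℂ)⁻¹) l))
        (fun a a' => B₀ * 1 * B6.c1 d ((1 - 1 / 100) * (24 / 25 * δ)) (1 / 100) * 2 * 1 * 1 *
          Real.exp (-(rateG δ * g.dist a a')))) := by
  -- abbreviations
  set Λ : ℝ := Λf (1 / 100) with hΛ_def
  set Λb : ℝ := Λf (1 / 100 * (24 / 25)) with hΛb_def
  set Λc : ℝ := Λf (1 / 100 * (1 - 1 / 100) * (1 - 1 / 100) * (24 / 25)) with hΛc_def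
  set c : ℝ := B6.c1 d δ (1 / 100) with hc_def
  set ρf : ℝ := 24 / 25 * δ with hρf
  set ρm : ℝ := 49 / 50 * δ with hρm
  set cL : ℝ := B6.c1 d ρf (1 / 100) with hcL
  set cR : ℝ := B6.c1 d ((1 - 1 / 100) * ρf) (1 / 100) with hcR
  set ΘL : ℝ := thetaGL (Fintype.card κ) (Fintype.card ι) d B₀ C₀ M₂ (∑ i, ‖b i‖) d₀ δ Λ κ₁ κQ cF abar α₁ with hΘL
  set ΘR : ℝ := thetaGR (Fintype.card κ) (Fintype.card ι) d B₀ C₀ M₂ (∑ i, ‖b i‖) d₀ δ Λ κ₁ κQ cF abar α₁ with hΘR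
  have hΛ1 : 1 ≤ Λ := hΛf _ (by norm_num)
  have hΛ0 : 0 ≤ Λ := zero_le_one.trans hΛ1
  have hΛb0 : 0 ≤ Λb := zero_le_one.trans (hΛf _ (by norm_num))
  have hΛc0 : 0 ≤ Λc := zero_le_one.trans (hΛf _ (by norm_num))
  have hc0 : 0 ≤ c := B6RandomWalk.c1_nonneg _ _ _
  have hcL0 : 0 ≤ cL := B6RandomWalk.c1_nonneg _ _ _
  have hcR0 : 0 ≤ cR := B6RandomWalk.c1_nonneg _ _ _
  have hSb : 0 ≤ ∑ i, ‖b i‖ := Finset.sum_nonneg fun i _ => norm_nonneg _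
  have hΘL0 : 0 ≤ ΘL := thetaGL_nonneg _ _ _ hB₀ hC₀ hM₂ hSb hΛ0 hκ₁ hκQ hcF habar hα₁
  have hΘR0 : 0 ≤ ΘR := thetaGR_nonneg _ _ _ hB₀ hC₀ hM₂ hSb hΛ0 hκ₁ hκQ hcF habar hα₁
  have hδ0 : 0 ≤ δ := hδ.le
  have hρf0 : 0 ≤ ρf := by positivity
  have hρm0 : 0 ≤ ρm := by positivity
  have hρfδ : ρf ≤ δ := by rw [hρf]; nlinarith
  have hρmδ : ρm ≤ δ := by rw [hρm]; nlinarith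
  have hκ₂ : 0 ≤ kappa383 κQ cF abar Λ c α₁ := kappa383_nonneg hκQ hcF habar hΛ0 hc0 hα₁
  have hw2 : ∀ a : g.Site, 0 ≤ g.len a ^ 2 := fun a => sq_nonneg _
  have hw1 : ∀ a : g.Site, 0 ≤ g.len a := fun a => (hlen a).le
  have hw1i : ∀ a : g.Site, 0 ≤ (g.len a)⁻¹ := fun a => inv_nonneg.mpr (hlen a).le
  have hw2i : ∀ a : g.Site, 0 ≤ (g.len a ^ 2)⁻¹ := fun a => inv_nonneg.mpr (sq_nonneg _)
  have hw0 : ∀ _a : g.Site, 0 ≤ (1 : ℝ) := fun _ => zero_le_one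
  -- (3.35) on the plaquettes adjacent to each bond
  have h35' := norm_plaqU_adjacent_of_through T U blk hC₀ hU1 h35
  -- [4] Lemma 2.1 and the p. 398 transfers at the input rate `δ`, exponent 1/100
  have h261β : Ineq261 d (toB6 g Rr H) δ (1 / 100) := h261 _ (by norm_num) (by norm_num)
  obtain ⟨hT1, hT2, hT1i, hT2i⟩ := hST (1 / 100) (by norm_num)
  -- §A  (3.84) for the concrete letters: `Δ_a(U′U) = Δ_a(U) − V(A)`, `V = V₃ + P₁ + P₂`
  have h371 := conj_lapDDLetter_prodCfg (b := b) (T := T) (U := U) hη.ne' A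
  have h376 : conjHom b (gradLin T ((g.eta : ℂ)⁻¹) (prodCfg U g.eta A)) ∘ₗ (1 - W') ∘ₗ
        conjHom b (divLin T ((g.eta : ℂ)⁻¹) (prodCfg U g.eta A))
      = conjHom b (gradLin T ((g.eta : ℂ)⁻¹) U) ∘ₗ (1 - W) ∘ₗ conjHom b (divLin T ((g.eta : ℂ)⁻¹) U)
        - conj b (V₂Op T U g.eta A) - pOneConc b T U g.eta A W W' := by
    have e := eq376_concrete T U b hη.ne' A W (W' - W)
    rw [add_sub_cancel] at e
    rw [e, pOneConc]
  have h384 := eq384_sub _ _ (conj b (dPrimeLetter T U g.eta)) (conj b (dPrimeLetter T (prodCfg U g.eta A) g.eta)) _ _ _ _ _ _ Aop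
    _ _ _ _ _ h371 h376 h380 h380s
  rw [← conj_V₃Op_eq_vThree] at h384
  set V : Module.End ℝ ((κ × S) × ι → ℝ) :=
    vTotal (conj b (V₃Op T U g.eta A)) (pOneConc b T U g.eta A W W') (pTwo Qs Q F₂ F₂s Aop) with hV
  -- the resolvent identities (3.86) in both forms
  rw [h384] at hinvL hinvR
  have h365 : GExt = G + GExt * (V * G) := eq365_of_inverse hΔG hinvR
  have h365' : GExt = G + G * (V * GExt) := eq365_first_of_inverse hGΔ hinvL
  -- §B  (3.83): `P₂(A)` in block-ℓ² at the rate `49δ/50`, then lowered to `24δ/25`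
  have hrm : ρm + (1 / 100 + 1 / 100) * δ ≤ δ := by rw [hρm]; nlinarith
  have hP₂ := ineq383_l2 (R := Rr) (H := H) (fun q : (κ × S) × ι => blk q.1.2) d δ δ (1 / 100) (1 / 100) ρm Λ κQ cF abar α₁
    hκQ hcF habar hα₁ hΛ0 hρm0 (by norm_num) (by norm_num) hδ0 hrm hdnn htri h261β hT2i hQ hQs hF₂ hF₂s hAop
  have hP₂' := hasL2Majorant_rate_mono (R := Rr) (H := H) (fun q : (κ × S) × ι => blk q.1.2) (kappa383 κQ cF abar Λ c α₁ * α₁)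
    (fun a => (g.len a ^ 2)⁻¹) (mul_nonneg hκ₂ hα₁) hw2i (show ρf ≤ ρm by rw [hρf, hρm]; nlinarith) hdnn hP₂
  -- `P₁(A)` lowered to `24δ/25`
  have hP₁' := hasL2Majorant_rate_mono (R := Rr) (H := H) (fun q : (κ × S) × ι => blk q.1.2) (κ₁ * α₁)
    (fun a => (g.len a ^ 2)⁻¹) (mul_nonneg hκ₁ hα₁) hw2i hρfδ hdnn hP₁
  -- the members of G(U) lowered to `24δ/25`
  have g0' := hasL2Majorant_rate_mono (R := Rr) (H := H) (fun q : (κ × S) × ι => blk q.1.2) B₀ (fun a => g.len a ^ 2) hB₀ hw2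
    hρfδ hdnn h346_0
  have g1' := fun k => hasL2Majorant_rate_mono (R := Rr) (H := H) (fun q : (κ × S) × ι => blk q.1.2) B₀ (fun a => g.len a) hB₀ hw1
    hρfδ hdnn (h346_1 k)
  have g2' := fun k => hasL2Majorant_rate_mono (R := Rr) (H := H) (fun q : (κ × S) × ι => blk q.1.2) B₀ (fun a => g.len a) hB₀ hw1
    hρfδ hdnn (h346_2 k)
  have g3' := fun k l => hasL2Majorant_rate_mono (R := Rr) (H := H) (fun q : (κ × S) × ι => blk q.1.2) B₀ (fun _ => (1 : ℝ)) hB₀ hw0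
    hρfδ hdnn (h346_3 k l)
  have g4' := fun k l => hasL2Majorant_rate_mono (R := Rr) (H := H) (fun q : (κ × S) × ι => blk q.1.2) B₀ (fun _ => (1 : ℝ)) hB₀ hw0
    hρfδ hdnn (h346_4 k l)
  have g5' := fun k l => hasL2Majorant_rate_mono (R := Rr) (H := H) (fun q : (κ × S) × ι => blk q.1.2) B₀ (fun _ => (1 : ℝ)) hB₀ hw0
    hρfδ hdnn (h346_5 k l)
  -- §C  (3.85) in block-ℓ², LEFT: `V(A)G(U) ≺₂ Θ_L e^{−ρ_f d}`
  have hrf : ρf + (1 / 100 + 1 / 100) * δ ≤ δ := by rw [hρf]; nlinarith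
  have hV3G := ineq385_l2_V3G (Rr := Rr) (H := H) b T U blk d hη hL A C₀ d₀ M₂ δ δ (1 / 100) (1 / 100) ρf Λ B₀ α₁ hB₀ hα₁ hΛ0 hρf0
    (by norm_num) (by norm_num) hδ0 hδ0 hrf hC₀ hM₂ hrepr hdnn htri hlen h261β hT1 hT2 hsmall hU1 hA hAτB hAτF h337B h337F h337B' hAst
    hAloc hdAst h35 hd₀B hd₀F hd₀FB hd₀st hd₀loc hd₀0 h346_0 h346_1
  have hP1G := ineq385_l2_P2G (R := Rr) (H := H) (fun q : (κ × S) × ι => blk q.1.2) d δ δ (1 / 100) (1 / 100) ρf Λ κ₁ B₀ α₁ hκ₁ hB₀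
    hα₁ hΛ0 hρf0 hrf hdnn htri hlen h261β hT2 hP₁ g0'
  have hrfm : ρf + (1 / 100 + 1 / 100) * δ ≤ ρm := by rw [hρf, hρm]; nlinarith
  have hP2G := ineq385_l2_P2G (R := Rr) (H := H) (fun q : (κ × S) × ι => blk q.1.2) d δ ρm (1 / 100) (1 / 100) ρf Λ
    (kappa383 κQ cF abar Λ c α₁) B₀ α₁ hκ₂ hB₀ hα₁ hΛ0 hρf0 hrfm hdnn htri hlen h261β hT2 hP₂ g0'
  have hVG : HasL2Majorant (g := toB6 g Rr H) (fun q : (κ × S) × ι => blk q.1.2) (V * G)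
      (fun a a' => ΘL * Real.exp (-(ρf * g.dist a a'))) := by
    have h := hasL2Majorant_add (g := toB6 g Rr H) _ (hasL2Majorant_add (g := toB6 g Rr H) _ hV3G hP1G) hP2G
    rw [hV, vTotal, add_mul, add_mul]
    refine hasL2Majorant_mono (g := toB6 g Rr H) _ h fun a a' => le_of_eq ?_
    rw [hΘL, thetaGL]
    ring
  -- §D  (3.85) in block-ℓ², RIGHT: `G(U)V(A) ≺₂ Θ_R e^{−ρ_f d}` and at the letter ∇: `∇_kG(U)V(A) ≺₂ Θ_R (Lʲη)⁻¹ e^{−ρ_f d}`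
  have hGV3 := ineq385_l2_GV3 (Rr := Rr) (H := H) b T U blk d hη hL A C₀ d₀ M₂ δ δ (1 / 100) (1 / 100) ρf Λ B₀ α₁ hB₀ hα₁ hΛ0 hρf0
    (by norm_num) (by norm_num) hδ0 hδ0 hrf hC₀ hM₂ hrepr hdnn htri hlen h261β hT1i hT2i hsmall hT hU1 hA hAτB hAτF hAFB h337B h337F
    h337B' h337Bτ h337FB hAst hAloc hdAst h35 h35' hd₀B hd₀F hd₀FB hd₀st hd₀loc hd₀0 h346_0 h346_2
  have hGP1 := ineq385_l2_GP2 (R := Rr) (H := H) (fun q : (κ × S) × ι => blk q.1.2) d δ δ (1 / 100) (1 / 100) ρf Λ κ₁ B₀ α₁ hκ₁ hB₀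
    hα₁ hΛ0 hρf0 hrf hdnn htri hlen h261β hT2i h346_0 hP₁'
  have hGP2 := ineq385_l2_GP2 (R := Rr) (H := H) (fun q : (κ × S) × ι => blk q.1.2) d δ δ (1 / 100) (1 / 100) ρf Λ
    (kappa383 κQ cF abar Λ c α₁) B₀ α₁ hκ₂ hB₀ hα₁ hΛ0 hρf0 hrf hdnn htri hlen h261β hT2i h346_0 hP₂'
  have hGV : HasL2Majorant (g := toB6 g Rr H) (fun q : (κ × S) × ι => blk q.1.2) (G * V)
      (fun a a' => ΘR * Real.exp (-(ρf * g.dist a a'))) := by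
    have h := hasL2Majorant_add (g := toB6 g Rr H) _ (hasL2Majorant_add (g := toB6 g Rr H) _ hGV3 hGP1) hGP2
    rw [hV, vTotal, mul_add, mul_add]
    refine hasL2Majorant_mono (g := toB6 g Rr H) _ h fun a a' => le_of_eq ?_
    rw [hΘR, thetaGR]
    ring
  have hXV : ∀ k : κ ⊕ κ, HasL2Majorant (g := toB6 g Rr H) (fun q : (κ × S) × ι => blk q.1.2)
      (conj b (diffLetter (bT T) (bU U) ((g.eta : ℂ)⁻¹) k) * G * V)
      (fun a a' => ΘR * (g.len a)⁻¹ * Real.exp (-(ρf * g.dist a a'))) := by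
    intro k
    have hD3 := ineq385_l2_DGV3 (Rr := Rr) (H := H) b T U blk d hη hL A C₀ d₀ M₂ δ δ (1 / 100) (1 / 100) ρf Λ B₀ α₁ hB₀ hα₁ hΛ0
      hρf0 (by norm_num) (by norm_num) hδ0 hδ0 hrf hC₀ hM₂ hrepr hdnn htri hlen h261β hT1i hT2i hsmall hT hU1 hA hAτB hAτF hAFB h337B
      h337F h337B' h337Bτ h337FB hAst hAloc hdAst h35 h35' hd₀B hd₀F hd₀FB hd₀st hd₀loc hd₀0 (h346_1 k) (h346_4 k)
    have hD1 := ineq385_l2_XP2 (R := Rr) (H := H) (fun q : (κ × S) × ι => blk q.1.2) d δ δ (1 / 100) (1 / 100) ρf Λ κ₁ B₀ α₁ hκ₁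
      hB₀ hα₁ hΛ0 hρf0 hrf hdnn htri hlen h261β hT2i (h346_1 k) hP₁'
    have hD2 := ineq385_l2_XP2 (R := Rr) (H := H) (fun q : (κ × S) × ι => blk q.1.2) d δ δ (1 / 100) (1 / 100) ρf Λ
      (kappa383 κQ cF abar Λ c α₁) B₀ α₁ hκ₂ hB₀ hα₁ hΛ0 hρf0 hrf hdnn htri hlen h261β hT2i (h346_1 k) hP₂'
    have h := hasL2Majorant_add (g := toB6 g Rr H) _ (hasL2Majorant_add (g := toB6 g Rr H) _ hD3 hD1) hD2
    rw [hV, vTotal, mul_add, mul_add]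
    refine hasL2Majorant_mono (g := toB6 g Rr H) _ h fun a a' => le_of_eq ?_
    rw [hΘR, thetaGR]
    ring
  -- §E  smallness and the Neumann factors
  have hsL2 : ΘL * cL ≤ 1 / 2 := hsmallL
  have hsR2 : ΘR * cR ≤ 1 / 2 := hsmallR
  have hsL : ΘL * cL < 1 := by linarith
  have hsR : ΘR * cR < 1 := by linarith
  have hfL : (1 - ΘL * cL)⁻¹ ≤ 2 := by
    have hpos : 0 < 1 - ΘL * cL := by linarith
    rw [inv_le_comm₀ hpos (by norm_num : (0 : ℝ) < 2)]
    linarith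
  have hfR : (1 - ΘR * cR)⁻¹ ≤ 2 := by
    have hpos : 0 < 1 - ΘR * cR := by linarith
    rw [inv_le_comm₀ hpos (by norm_num : (0 : ℝ) < 2)]
    linarith
  -- Lemma 2.1 at the walks' rates by rescaling; the p. 398 transfers of `Lʲη` at the right walk's rates
  have h261L : Ineq261 d (toB6 g Rr H) ρf (1 / 100) := by
    rw [hρf]; exact ineq261_rescale (h261 (1 / 100 * (24 / 25)) (by norm_num) (by norm_num))
  have h261R : Ineq261 d (toB6 g Rr H) ((1 - 1 / 100) * ρf) (1 / 100) := by
    rw [hρf]; exact ineq261_rescale (ineq261_rescale (h261 (1 / 100 * (1 - 1 / 100) * (24 / 25)) (by norm_num) (by norm_num)))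
  have hTb : ScaleTransfer g ρf (1 / 100) Λb (fun a => g.len a) := by
    rw [hρf, hΛb_def]; exact scaleTransfer_rescale (hST (1 / 100 * (24 / 25)) (by norm_num)).1
  have hTc : ScaleTransfer g ((1 - 1 / 100) * ((1 - 1 / 100) * ρf)) (1 / 100) Λc (fun a => g.len a) := by
    rw [hρf, hΛc_def]
    exact scaleTransfer_rescale (scaleTransfer_rescale (scaleTransfer_rescale
      (hST (1 / 100 * (1 - 1 / 100) * (1 - 1 / 100) * (24 / 25)) (by norm_num)).1))
  have hTb1 : ScaleTransfer g ρf (1 / 100) 1 (fun _ => (1 : ℝ)) := scaleTransfer_one (by positivity) hdnn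
  have hTc1 : ScaleTransfer g ((1 - 1 / 100) * ((1 - 1 / 100) * ρf)) (1 / 100) 1 (fun _ => (1 : ℝ)) :=
    scaleTransfer_one (by positivity) hdnn
  -- the output rate dominates: `rateG δ ≦ (99/100)ρ_f` and `= (99/100)³ρ_f`
  have hrateL : rateG δ ≤ (1 - 1 / 100) * ρf := by rw [rateG, hρf]; nlinarith
  have hrateR : rateG δ = (1 - 1 / 100) * ((1 - 1 / 100) * ((1 - 1 / 100) * ρf)) := by rw [rateG, hρf]
  -- §F  the LEFT members 0, 1, 3 by the ℓ²-summed walk (3.86)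
  have left : ∀ (X : Module.End ℝ ((κ × S) × ι → ℝ)) (P : g.Site → ℝ), (∀ y, 0 ≤ P y) →
      HasL2Majorant (g := toB6 g Rr H) (fun q : (κ × S) × ι => blk q.1.2) (X * G)
        (fun a a' => B₀ * P a * Real.exp (-(ρf * g.dist a a'))) →
      HasL2Majorant (g := toB6 g Rr H) (fun q : (κ × S) × ι => blk q.1.2) (X * GExt)
        (fun a a' => B₀ * cL * 2 * P a * Real.exp (-(rateG δ * g.dist a a'))) := by
    intro X P hP hX
    have h := hasL2Majorant_leftEntry_gpExt (R := Rr) (H := H) (fun q : (κ × S) × ι => blk q.1.2) d ρf (1 / 100) ΘL B₀ P hB₀ hP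
      hΘL0 hρf0 (by norm_num) htri hrefl hdnn h261L hsL h365 hX hVG
    have h' : HasL2Majorant (g := toB6 g Rr H) (fun q : (κ × S) × ι => blk q.1.2) (X * GExt)
        (fun a a' => B₀ * cL * 2 * P a * Real.exp (-((1 - 1 / 100) * ρf * g.dist a a'))) := by
      refine hasL2Majorant_mono (g := toB6 g Rr H) _ h fun a a' => ?_
      have he : 0 ≤ P a * Real.exp (-((1 - 1 / 100) * ρf * g.dist a a')) := mul_nonneg (hP a) (Real.exp_nonneg _)
      calc B₀ * B6.c1 d ρf (1 / 100) * (1 - ΘL * B6.c1 d ρf (1 / 100))⁻¹ * P a * Real.exp (-((1 - 1 / 100) * ρf * g.dist a a'))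
          = (B₀ * cL * (1 - ΘL * cL)⁻¹) * (P a * Real.exp (-((1 - 1 / 100) * ρf * g.dist a a'))) := by rw [hcL]; ring
        _ ≤ (B₀ * cL * 2) * (P a * Real.exp (-((1 - 1 / 100) * ρf * g.dist a a'))) :=
            mul_le_mul_of_nonneg_right (mul_le_mul_of_nonneg_left hfL (by positivity)) he
        _ = _ := by ring
    exact hasL2Majorant_rate_mono (R := Rr) (H := H) (fun q : (κ × S) × ι => blk q.1.2) (B₀ * cL * 2) P (by positivity) hP hrateL
      hdnn h'
  -- §G  the RIGHT members 2, 5 by the left-routed ℓ²-summed walk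
  have right : ∀ (Y : Module.End ℝ ((κ × S) × ι → ℝ)) (P : g.Site → ℝ) (Λ₁ Λ₂ : ℝ), 0 ≤ Λ₁ → (∀ y, 0 ≤ P y) →
      ScaleTransfer g ρf (1 / 100) Λ₁ P → ScaleTransfer g ((1 - 1 / 100) * ((1 - 1 / 100) * ρf)) (1 / 100) Λ₂ P →
      HasL2Majorant (g := toB6 g Rr H) (fun q : (κ × S) × ι => blk q.1.2) (G * Y)
        (fun a a' => B₀ * P a * Real.exp (-(ρf * g.dist a a'))) →
      HasL2Majorant (g := toB6 g Rr H) (fun q : (κ × S) × ι => blk q.1.2) (GExt * Y)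
        (fun a a' => B₀ * Λ₁ * cR * 2 * Λ₂ * P a * Real.exp (-(rateG δ * g.dist a a'))) := by
    intro Y P Λ₁ Λ₂ hΛ₁ hP hT₁ hT₂ hY
    have h365'' : GExt = G + G * (V * GExt) := h365'
    have h := hasL2Majorant_rightEntry_gpExt (R := Rr) (H := H) (fun q : (κ × S) × ι => blk q.1.2) d ρf (1 / 100) (1 / 100) (1 / 100)
      ΘR B₀ Λ₁ Λ₂ P hB₀ hΛ₁ hP hΘR0 hρf0 (by norm_num) (by norm_num) (by norm_num) htri hrefl hsym hdnn h261R hsR hT₁ hT₂ h365'' hY hGV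
    rw [hrateR]
    refine hasL2Majorant_mono (g := toB6 g Rr H) _ h fun a a' => ?_
    have hΛ₂P : 0 ≤ Λ₂ * P a := by
      have := hT₂ a a
      have he : Real.exp (-(1 / 100 * ((1 - 1 / 100) * ((1 - 1 / 100) * ρf)) * g.dist a a)) = 1 := by rw [hrefl, mul_zero, neg_zero, Real.exp_zero]
      rw [he, one_mul] at this
      exact (hP a).trans this
    have he : 0 ≤ Λ₂ * P a * Real.exp (-((1 - 1 / 100) * ((1 - 1 / 100) * ((1 - 1 / 100) * ρf)) * g.dist a a')) :=
      mul_nonneg hΛ₂P (Real.exp_nonneg _)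
    calc B₀ * Λ₁ * B6.c1 d ((1 - 1 / 100) * ρf) (1 / 100) * (1 - ΘR * B6.c1 d ((1 - 1 / 100) * ρf) (1 / 100))⁻¹ * Λ₂ * P a *
          Real.exp (-((1 - 1 / 100) * ((1 - 1 / 100) * ((1 - 1 / 100) * ρf)) * g.dist a a'))
        = (B₀ * Λ₁ * cR * (1 - ΘR * cR)⁻¹) *
            (Λ₂ * P a * Real.exp (-((1 - 1 / 100) * ((1 - 1 / 100) * ((1 - 1 / 100) * ρf)) * g.dist a a'))) := by rw [hcR]; ring
      _ ≤ (B₀ * Λ₁ * cR * 2) * (Λ₂ * P a * Real.exp (-((1 - 1 / 100) * ((1 - 1 / 100) * ((1 - 1 / 100) * ρf)) * g.dist a a'))) :=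
          mul_le_mul_of_nonneg_right (mul_le_mul_of_nonneg_left hfR (by positivity)) he
      _ = _ := by ring
  -- §H  assembling the six members
  have e2 : ∀ k : κ ⊕ κ, HasL2Majorant (g := toB6 g Rr H) (fun q : (κ × S) × ι => blk q.1.2)
      (GExt * conj b (diffLetter (bT T) (bU U) ((g.eta : ℂ)⁻¹) k))
      (fun a a' => B₀ * Λb * cR * 2 * Λc * g.len a * Real.exp (-(rateG δ * g.dist a a'))) :=
    fun k => right _ (fun a => g.len a) Λb Λc hΛb0 hw1 hTb hTc (g2' k)
  refine ⟨?_, fun k => ?_, fun k => ?_, fun k l => ?_, fun k l => ?_, fun k l => ?_⟩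
  · -- member 0: `X = 1`, weight `(Lʲη)²`
    have hX : HasL2Majorant (g := toB6 g Rr H) (fun q : (κ × S) × ι => blk q.1.2) (1 * G)
        (fun a a' => B₀ * g.len a ^ 2 * Real.exp (-(ρf * g.dist a a'))) := by rw [one_mul]; exact g0'
    have h := left 1 (fun a => g.len a ^ 2) hw2 hX
    rw [one_mul] at h
    refine hasL2Majorant_mono (g := toB6 g Rr H) _ h fun a a' => le_of_eq ?_
    rw [hcL, hρf]
  · -- member 1: `X = ∇_k`, weight `Lʲη`
    have h := left _ (fun a => g.len a) hw1 (g1' k)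
    refine hasL2Majorant_mono (g := toB6 g Rr H) _ h fun a a' => le_of_eq ?_
    rw [hcL, hρf]
  · -- member 2: `Y = ∇♯_k`, weight `Lʲη`
    refine hasL2Majorant_mono (g := toB6 g Rr H) _ (e2 k) fun a a' => le_of_eq ?_
    rw [hcR, hρf, hΛb_def, hΛc_def]
  · -- member 3: `X = ∇_k∇_l`, weight 1
    have h := left _ (fun _ => (1 : ℝ)) hw0 (g3' k l)
    refine hasL2Majorant_mono (g := toB6 g Rr H) _ h fun a a' => le_of_eq ?_
    rw [hcL, hρf]
  · -- member 4 (mixed): `X = ∇_k`, `Y = ∇♯_l`, from the member at U, `∇_kG(U)V(A)` and the right entry of member 2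
    have hrx : rateG δ + (1 / 100 + 1 / 100) * δ ≤ ρf := by rw [rateG, hρf]; nlinarith
    have hXM : HasL2Majorant (g := toB6 g Rr H) (fun q : (κ × S) × ι => blk q.1.2)
        (conj b (diffLetter (bT T) (bU U) ((g.eta : ℂ)⁻¹) k) * G * V)
        (fun a a' => ΘR * (g.len a)⁻¹ * Real.exp (-(ρf * g.dist a a'))) := hXV k
    have h := hasL2Majorant_mixedEntry_gpExt (R := Rr) (H := H) (fun q : (κ × S) × ι => blk q.1.2) d δ ρf (1 / 100) (1 / 100)
      (rateG δ) Λ ΘR B₀ (B₀ * Λb * cR * 2 * Λc) hΘR0 hB₀ (by positivity) hΛ0 (rateG_pos hδ).le (by norm_num) (by norm_num) hδ0 hrx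
      hdnn htri hlen h261β hT1 h365' (g4' k l) hXM (e2 l)
    refine hasL2Majorant_mono (g := toB6 g Rr H) _ h fun a a' => ?_
    -- the α₁-dependent factor `Θ_R` is absorbed by the smallness `Θ_R c_R ≦ ½`
    have hE : 0 ≤ (1 : ℝ) * Real.exp (-(rateG δ * g.dist a a')) := mul_nonneg zero_le_one (Real.exp_nonneg _)
    have hX0 : 0 ≤ B₀ * Λb * Λc * Λ * c := by positivity
    have key : ΘR * (B₀ * Λb * cR * 2 * Λc) * Λ * c ≤ B₀ * Λb * Λc * Λ * c := by
      have e : ΘR * (B₀ * Λb * cR * 2 * Λc) * Λ * c = (ΘR * cR * 2) * (B₀ * Λb * Λc * Λ * c) := by ring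
      rw [e]
      have h2 : ΘR * cR * 2 ≤ 1 := by linarith
      calc (ΘR * cR * 2) * (B₀ * Λb * Λc * Λ * c) ≤ 1 * (B₀ * Λb * Λc * Λ * c) := mul_le_mul_of_nonneg_right h2 hX0
        _ = _ := one_mul _
    calc (B₀ + ΘR * (B₀ * Λb * cR * 2 * Λc) * Λ * B6.c1 d δ (1 / 100)) * 1 * Real.exp (-(rateG δ * g.dist a a'))
        = (B₀ + ΘR * (B₀ * Λb * cR * 2 * Λc) * Λ * c) * ((1 : ℝ) * Real.exp (-(rateG δ * g.dist a a'))) := by rw [hc_def]; ring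
      _ ≤ (B₀ + B₀ * Λb * Λc * Λ * c) * ((1 : ℝ) * Real.exp (-(rateG δ * g.dist a a'))) :=
          mul_le_mul_of_nonneg_right (by linarith [key]) hE
      _ = _ := by rw [hΛb_def, hΛc_def, hΛ_def, hc_def]; ring
  · -- member 5: `Y = ∇♯_k∇♯_l`, weight 1 (the two transfers are free)
    have hY : HasL2Majorant (g := toB6 g Rr H) (fun q : (κ × S) × ι => blk q.1.2)
        (G * (conj b (diffLetter (bT T) (bU U) ((g.eta : ℂ)⁻¹) k) * conj b (diffLetter (bT T) (bU U) ((g.eta : ℂ)⁻¹) l)))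
        (fun a a' => B₀ * (1 : ℝ) * Real.exp (-(ρf * g.dist a a'))) := by
      rw [← mul_assoc]; exact g5' k l
    have h := right _ (fun _ => (1 : ℝ)) 1 1 zero_le_one hw0 hTb1 hTc1 hY
    rw [← mul_assoc] at h
    refine hasL2Majorant_mono (g := toB6 g Rr H) _ h fun a a' => le_of_eq ?_
    rw [hcR, hρf]

end Assembly

end Literature.MathematicalPhysics.QuantumFieldTheory.Balaban1983to89.B9Thm34GL2Entries

end
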